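import Literature.Probability.LatticeModels.PlaneRotatorJensenRotationBound
import Literature.Probability.LatticeModels.PlaneRotatorEquipartitionBound
import Literature.Probability.LatticeModels.PlaneRotatorTorusBondSymmetry
import Literature.MathematicalPhysics.QuantumLattice.TorusEuclidLogDipoleGradient
import HarnessLib

/-!
# Energy-renormalised McBryan–Spencer decay for the two-dimensional XY model on `(ℤ/Lℤ)²`:
# an exponent strictly larger than the spin-wave value `1/(2πβJ)`, uniformly in the volume

Topic `Literature/Probability/LatticeModels`. McBryan–Spencer (O. A. McBryan, T. Spencer, Comm. Math.
Phys. **53** (1977) 299–302 [McBryanSpencer1977]; S. Friedli, Y. Velenik, *Statistical Mechanics of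
Lattice Systems* (CUP 2017), Thm. 9.12 [FriedliVelenik2017]; tree:
`torusXY_abs_expect_cosDiff_le_rpow(_spinWave)`, `PlaneRotatorPowerLawDecay.lean`) bound the
two-point function of the plane rotator at coupling `K = βJ` by `C·|x − y|^{−1/(2πK)}`, the spin-wave
exponent. The cost of their complex rotation is paid through the bond ENERGIES
(`BondSystem.abs_expectJ_cosDiff_le_exp_energy_cosh`, `PlaneRotatorJensenRotationBound.lean`), and on
the torus the nearest-neighbour bond energy `E_L(K) = ⟨cos(θ_{z+eᵢ} − θ_z)⟩_{K,L}` obeys the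
equipartition bound `E_L(K) ≤ 8K/(1 + 8K)` (local Ward identity, `BondSystem.siteEnergy_le`,
`PlaneRotatorEquipartitionBound.lean`, with the torus symmetry `torusXYBondEnergy_eq`). Hence, for
the nearest-neighbour plane rotator on `(ℤ/Lℤ)²`, `L ≥ 3`, uniformly in `L`:

* `torusXY_abs_expect_cosDiff_le_exp_energy_adj` — the a-priori bound in graph form with the energy
  factor: for `K ≥ 0`, every `φ` with `|φ_u − φ_v| ≤ M` on bonds,
  `|⟨cos(θ_x − θ_y)⟩_{K,L}| ≤ e^{−(φ_x−φ_y)} exp((K·E_L(cosh(M)K)/2) Σ_u Σ_{v∼u} (cosh(φ_u − φ_v) − 1))`;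
* `torusXYBondEnergy_le` — `E_L(K) ≤ 8K/(1 + 8K)` for `K > 0`, every `L ≥ 3`;
* `torusXY_abs_expect_cosDiff_le_rpow_of_bondEnergy_le` — for `q ≥ 0`, any `E ≥ E_L(cosh(q log 2)·K)`
  (`E ≥ 0`) and `f = 2q − 2πK·E·q² ≥ 0`:
  `|⟨cos(θ_x − θ_y)⟩_{K,L}| ≤ exp(K E (2πq² + 76q² + 544q⁴e^{2q²})) · 5^f · (dist(x,y) + 1)^{−f}`
  (the **energy class**: a certified energy ceiling `E` renormalises the exponent to `≈ 1/(2πK E)`);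
* `torusXY_abs_expect_cosDiff_le_rpow_renormalized` — the same with the explicit
  `E = ε_K(q) := 8K′/(1 + 8K′)`, `K′ = cosh(q log 2)·K`;
* `torusXY_abs_expect_cosDiff_le_rpow_renormalizedSpinWave` — at the McBryan–Spencer charge
  `q₀ = 1/(2πK)` (`K > 0`): **exponent `f₀ = (1 + 1/(1 + 8K′))/(2πK) > 1/(2πK)`**,
  `K′ = cosh(log 2/(2πK))·K`, with an explicit constant — a strict, `L`-uniform improvement of the
  McBryan–Spencer / spin-wave exponent (`renormalizedSpinWave_exponent_gt`; e.g. `+10 %` at `K = 1.12`).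

Reading (cell `pub/hubbard-tc`, START-HERE §6 crux №2 «sharp Koma–Tasaki», classical half): this is
the ENERGY-class sharpening — the coupling `J` in the spin-wave exponent is replaced by
`J·ε` with `ε < 1` an upper bound on the bond energy `⟨cos ∇θ⟩`, the classical counterpart of the
kinetic (f-sum) class reached for the Hubbard model by
`Literature.MathematicalPhysics.QuantumLattice.norm_thermalCorr_bondPair_torus_le_rpow_of_thermalCost`;
the STIFFNESS class (helicity modulus `Υ ≤ J·⟨cos ∇θ⟩` in the exponent) remains open. Physically
`1 − E_L(K) ≈ 1/(4K)` (spin waves) while the bound gives `1 − ε = 1/(1 + 8K)`.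

## References

* O. A. McBryan, T. Spencer, Comm. Math. Phys. 53 (1977) 299–302. [McBryanSpencer1977]
* S. Friedli, Y. Velenik, *Statistical Mechanics of Lattice Systems*, CUP 2017, Thm. 9.12, (9.21)–(9.23).
  [FriedliVelenik2017]
* M. Aizenman, B. Simon, Comm. Math. Phys. 77 (1980) 137–143, eq. (2.4). [AizenmanSimon1980LocalWard]

Tree: `BondSystem.abs_expectJ_cosDiff_le_exp_energy_cosh`, `BondSystem.expect_one_eq_expectJ`,
`BondSystem.siteEnergy_le`, `torusXYBondEnergy_eq`, `le_rpow_euclid_of_apriori_grad`; the two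
torus-sum lemmas of `PlaneRotatorPowerLawDecay.lean` are re-proved privately.
-/

noncomputable section

open MeasureTheory Finset
open scoped BigOperators

namespace Literature.Probability.LatticeModels

open Literature.MathematicalPhysics.QuantumLattice (torusNormSq torusDist le_rpow_euclid_of_apriori_grad)

section TorusSums

variable {d L : ℕ} [NeZero L]

/-- For `L ≥ 3`, the neighbours of `x` in the torus graph are the `2d` distinct points `x ± eᵢ`:
`Σ_{y ∼ x} g(y) = Σᵢ (g(x + eᵢ) + g(x − eᵢ))` (re-proved from `PlaneRotatorPowerLawDecay.lean`, where
it is private). [folklore] -/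
private theorem sum_ite_torusGraph_adj_real' (hL : 3 ≤ L) (x : TorusSite d L) (g : TorusSite d L → ℝ) :
    (∑ y, if (torusGraph d L).Adj x y then g y else 0) =
      ∑ i, (g (x + Pi.single i 1) + g (x - Pi.single i 1)) := by
  classical
  haveI : Fact (1 < L) := ⟨by omega⟩
  have h1 : (1 : ZMod L) ≠ 0 := one_ne_zero
  have h2 : (1 : ZMod L) + 1 ≠ 0 := by
    intro h
    have : ((2 : ℕ) : ZMod L) = 0 := by exact_mod_cast (by simpa [one_add_one_eq_two] using h)
    rw [ZMod.natCast_eq_zero_iff] at this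
    exact absurd (Nat.le_of_dvd two_pos this) (by omega)
  have hsingle_ne : ∀ i : Fin d, (Pi.single i 1 : TorusSite d L) ≠ 0 := fun i h => by
    have := congrFun h i; simp [h1] at this
  have hsingle_inj : ∀ i j : Fin d, (Pi.single i 1 : TorusSite d L) = Pi.single j 1 → i = j := by
    intro i j h
    by_contra hij
    have := congrFun h i
    simp [hij, h1] at this
  have hsum_ne : ∀ i j : Fin d, (Pi.single i 1 : TorusSite d L) + Pi.single j 1 ≠ 0 := by
    intro i j h
    have := congrFun h i
    by_cases hij : i = j
    · subst hij; simp [h2] at this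
    · simp [Ne.symm hij, h1] at this
  set Np : Finset (TorusSite d L) := univ.image fun i => x + Pi.single i 1 with hNp
  set Nm : Finset (TorusSite d L) := univ.image fun i => x - Pi.single i 1 with hNm
  have hadj : ∀ y, (torusGraph d L).Adj x y ↔ y ∈ Np ∪ Nm := by
    intro y
    rw [torusGraph_adj_iff, Finset.mem_union, Finset.mem_image, Finset.mem_image]
    constructor
    · rintro ⟨-, ⟨i, hi⟩ | ⟨i, hi⟩⟩
      · exact Or.inl ⟨i, mem_univ _, hi.symm⟩
      · exact Or.inr ⟨i, mem_univ _, by rw [hi, add_sub_cancel_right]⟩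
    · rintro (⟨i, -, hi⟩ | ⟨i, -, hi⟩)
      · refine ⟨fun hxy => hsingle_ne i ?_, Or.inl ⟨i, hi.symm⟩⟩
        have := hi; rw [← hxy] at this; simpa using this.symm
      · refine ⟨fun hxy => hsingle_ne i ?_, Or.inr ⟨i, by rw [← hi, sub_add_cancel]⟩⟩
        have := hi; rw [← hxy, sub_eq_self] at this; exact this
  have hdisj : Disjoint Np Nm := by
    rw [Finset.disjoint_left]
    intro y hp hm
    rw [hNp, Finset.mem_image] at hp
    rw [hNm, Finset.mem_image] at hm
    obtain ⟨i, -, rfl⟩ := hp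
    obtain ⟨j, -, hj⟩ := hm
    apply hsum_ne i j
    have := hj
    rw [sub_eq_iff_eq_add, add_assoc, left_eq_add] at this
    exact this
  have hinjp : Set.InjOn (fun i : Fin d => x + Pi.single i 1) (univ : Finset (Fin d)) :=
    fun i _ j _ h => hsingle_inj i j (add_left_cancel h)
  have hinjm : Set.InjOn (fun i : Fin d => x - Pi.single i 1) (univ : Finset (Fin d)) :=
    fun i _ j _ h => hsingle_inj i j (sub_right_injective h)
  calc (∑ y, if (torusGraph d L).Adj x y then g y else 0)
      = ∑ y, if y ∈ Np ∪ Nm then g y else 0 := by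
        refine Finset.sum_congr rfl fun y _ => ?_
        simp only [hadj]
    _ = ∑ y ∈ Np ∪ Nm, g y := by rw [Finset.sum_ite_mem, Finset.univ_inter]
    _ = ∑ y ∈ Np, g y + ∑ y ∈ Nm, g y := Finset.sum_union hdisj
    _ = ∑ i, g (x + Pi.single i 1) + ∑ i, g (x - Pi.single i 1) := by
        rw [hNp, hNm, Finset.sum_image hinjp, Finset.sum_image hinjm]
    _ = ∑ i, (g (x + Pi.single i 1) + g (x - Pi.single i 1)) := (Finset.sum_add_distrib).symm

/-- Ordered adjacent pairs are twice the directed bonds `(x, x + eᵢ)` (`L ≥ 3`, symmetric kernel):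
`Σ_x Σ_{y ∼ x} F(x,y) = 2 Σ_x Σᵢ F(x, x + eᵢ)` (re-proved from `PlaneRotatorPowerLawDecay.lean`).
[folklore] -/
private theorem sum_sum_ite_torusGraph_adj_real' (hL : 3 ≤ L) (F : TorusSite d L → TorusSite d L → ℝ)
    (hF : ∀ x y, F x y = F y x) :
    (∑ x, ∑ y, if (torusGraph d L).Adj x y then F x y else 0) =
      2 * ∑ x : TorusSite d L, ∑ i : Fin d, F x (x + Pi.single i 1) := by
  have hkey : ∀ x : TorusSite d L, (∑ y, if (torusGraph d L).Adj x y then F x y else 0) =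
      ∑ i, (F x (x + Pi.single i 1) + F x (x - Pi.single i 1)) := fun x =>
    sum_ite_torusGraph_adj_real' hL x (F x)
  simp_rw [hkey, sum_add_distrib]
  rw [two_mul]
  congr 1
  rw [sum_comm]
  conv_rhs => rw [sum_comm]
  refine sum_congr rfl fun i _ => ?_
  refine (Fintype.sum_equiv (Equiv.addRight (Pi.single i (1 : ZMod L)))
    (fun x => F x (x + Pi.single i 1)) (fun x => F x (x - Pi.single i 1)) fun x => ?_).symm
  simp only [Equiv.coe_addRight, add_sub_cancel_right]
  exact hF _ _

end TorusSums

/-! ### The torus bond system: sources, targets, site charges -/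

section TorusBonds

variable {L : ℕ} [NeZero L]

omit [NeZero L] in
/-- The source of the bond `(z, i)` is `z`. [folklore] -/
private theorem torusXY_src' (b : TorusSite 2 L × Fin 2) : (torusXY 2 L).src b = b.1 := rfl

omit [NeZero L] in
/-- The target of the bond `(z, i)` is `z + eᵢ`. [folklore] -/
private theorem torusXY_tgt' (b : TorusSite 2 L × Fin 2) : (torusXY 2 L).tgt b = b.1 + Pi.single b.2 1 := rfl

omit [NeZero L] in
/-- For `L ≥ 2` the unit vectors of `(ℤ/Lℤ)²` are non-zero. [folklore] -/
private theorem single_one_ne_zero (hL : 3 ≤ L) (i : Fin 2) : (Pi.single i 1 : TorusSite 2 L) ≠ 0 := by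
  haveI : Fact (1 < L) := ⟨by omega⟩
  intro h
  have := congrFun h i
  simp at this

omit [NeZero L] in
/-- For `L ≥ 3` every bond `z → z + eᵢ` of the torus joins adjacent (distinct) sites.
[cite: FriedliVelenik2017, §3.1 (torus)] -/
theorem torusXY_adj_src_tgt (hL : 3 ≤ L) (b : TorusSite 2 L × Fin 2) :
    (torusGraph 2 L).Adj ((torusXY 2 L).src b) ((torusXY 2 L).tgt b) := by
  rw [torusXY_src', torusXY_tgt', torusGraph_adj_iff]
  refine ⟨fun h => single_one_ne_zero hL b.2 ?_, Or.inl ⟨b.2, rfl⟩⟩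
  have := h.symm
  rwa [add_eq_left] at this

omit [NeZero L] in
/-- The squared site charge of a torus bond at `x`: `k_{(z,i)}(x)² = [z + eᵢ = x] + [z = x]` (the two
cases exclude each other since `eᵢ ≠ 0`). [cite: AizenmanSimon1980LocalWard, eq. (2.4) (rotation of one spin)] -/
theorem torusXY_siteCharge_sq (hL : 3 ≤ L) (x : TorusSite 2 L) (b : TorusSite 2 L × Fin 2) :
    (torusXY 2 L).siteCharge x b ^ 2 =
      (if b.1 + Pi.single b.2 1 = x then 1 else 0) + (if b.1 = x then 1 else 0) := by
  rw [BondSystem.siteCharge_eq, torusXY_src', torusXY_tgt']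
  by_cases h1 : b.1 + Pi.single b.2 1 = x <;> by_cases h2 : b.1 = x
  · exfalso
    rw [h2] at h1
    exact single_one_ne_zero hL b.2 (by rwa [add_eq_left] at h1)
  · rw [if_pos h1, if_neg h2]; norm_num
  · rw [if_neg h1, if_pos h2]; norm_num
  · rw [if_neg h1, if_neg h2]; norm_num

/-- The local coupling sum of the uniform torus is `S_x = 4K` (two outgoing and two incoming bonds).
[cite: AizenmanSimon1980LocalWard, Thm 3.1 (local coupling sum ∑_y J_{xy})] -/
theorem torusXY_siteCouplingSum (hL : 3 ≤ L) (K : ℝ) (x : TorusSite 2 L) :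
    (torusXY 2 L).siteCouplingSum (fun _ => K) x = 4 * K := by
  unfold BondSystem.siteCouplingSum
  simp_rw [torusXY_siteCharge_sq hL x, mul_add, Finset.sum_add_distrib, ← Finset.mul_sum,
    Fintype.sum_prod_type]
  have hA : ∑ z : TorusSite 2 L, ∑ i : Fin 2, (if z + Pi.single i 1 = x then (1 : ℝ) else 0) = 2 := by
    rw [Finset.sum_comm]
    have : ∀ i : Fin 2, ∑ z : TorusSite 2 L, (if z + Pi.single i 1 = x then (1 : ℝ) else 0) = 1 := by
      intro i
      have heq : ∀ z : TorusSite 2 L, (z + Pi.single i 1 = x) = (z = x - Pi.single i 1) := fun z =>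
        propext eq_sub_iff_add_eq.symm
      simp_rw [heq, Finset.sum_ite_eq', Finset.mem_univ, if_true]
    simp_rw [this]
    norm_num
  have hB : ∑ z : TorusSite 2 L, ∑ _i : Fin 2, (if z = x then (1 : ℝ) else 0) = 2 := by
    simp_rw [Finset.sum_const, Finset.card_univ, Fintype.card_fin]
    rw [show (∑ z : TorusSite 2 L, (2 : ℕ) • (if z = x then (1 : ℝ) else 0)) =
      ∑ z : TorusSite 2 L, (if z = x then (2 : ℝ) else 0) from
      Finset.sum_congr rfl fun z _ => by split_ifs <;> simp, Finset.sum_ite_eq', if_pos (mem_univ _)]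
  rw [hA, hB]
  ring

variable [MeasurableSpace Circle] [BorelSpace Circle]

/-- The general-coupling expectation of a bond cosine at uniform coupling `K` is the torus bond
energy of `PlaneRotatorTorusBondSymmetry.lean`. [cite: Ginibre1970, Example 4 (plane rotators)] -/
theorem torusXY_expectJ_reChar_bondChar (K : ℝ) (b : TorusSite 2 L × Fin 2) :
    (torusXY 2 L).expectJ (fun _ => K) (reChar ((torusXY 2 L).bondChar b)) = torusXYBondEnergy L K b := rfl

/-- The local energy of the uniform torus is `e_x = 4K·E_L(K)`. [cite: AizenmanSimon1980LocalWard, eq. (2.4) with A = ∂H/∂θ_x (N = 2)] -/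
theorem torusXY_siteEnergy (hL : 3 ≤ L) (K : ℝ) (x : TorusSite 2 L) :
    (torusXY 2 L).siteEnergy (fun _ => K) x = 4 * K * torusXYBondEnergy L K (0, 0) := by
  unfold BondSystem.siteEnergy
  have hE : ∀ b : TorusSite 2 L × Fin 2, ginibreExpect (torusHaar (TorusSite 2 L)) (torusXY 2 L).bondChar
      (fun _ => K) (reChar ((torusXY 2 L).bondChar b)) = torusXYBondEnergy L K (0, 0) := fun b =>
    torusXYBondEnergy_eq K b (0, 0)
  simp_rw [hE, ← Finset.sum_mul]
  have hS := torusXY_siteCouplingSum hL K x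
  unfold BondSystem.siteCouplingSum at hS
  rw [hS]

/-- **The bond energy of the two-dimensional torus is at most `8K/(1 + 8K)`**: for the
nearest-neighbour plane rotator on `(ℤ/Lℤ)²`, `L ≥ 3`, at coupling `K > 0`,
`E_L(K) = ⟨cos(θ_{z+eᵢ} − θ_z)⟩_{K,L} ≤ 8K/(1 + 8K)` for every bond and every `L` (equipartition
identity at a site: `4K·E_L ≤ 2(4K)²/(1 + 8K)`). [cite: AizenmanSimon1980LocalWard, eq. (2.4) with A = ∂H/∂θ_x (N = 2)] -/
theorem torusXYBondEnergy_le (hL : 3 ≤ L) {K : ℝ} (hK : 0 < K) (b : TorusSite 2 L × Fin 2) :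
    torusXYBondEnergy L K b ≤ 8 * K / (1 + 8 * K) := by
  rw [torusXYBondEnergy_eq K b (0, 0)]
  have h := (torusXY 2 L).siteEnergy_le (J := fun _ => K) (fun _ => hK.le) (0 : TorusSite 2 L)
  rw [torusXY_siteEnergy hL K 0, torusXY_siteCouplingSum hL K 0] at h
  have h18 : (0 : ℝ) < 1 + 8 * K := by linarith
  rw [le_div_iff₀ h18]
  have h' : 4 * K * torusXYBondEnergy L K (0, 0) * (1 + 2 * (4 * K)) ≤ 2 * (4 * K) ^ 2 := by
    have := (le_div_iff₀ (by linarith : (0 : ℝ) < 1 + 2 * (4 * K))).1 h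
    linarith
  nlinarith

/-- `K · E_L(K′) ≤ K · 8K′/(1 + 8K′)` for `0 ≤ K` and `K′ = c·K` with `c ≥ 1` (the form used with the
modulated coupling `K′ = cosh(M)·K`; trivial for `K = 0`). [cite: AizenmanSimon1980LocalWard, eq. (2.4) with A = ∂H/∂θ_x (N = 2)] -/
theorem mul_torusXYBondEnergy_le (hL : 3 ≤ L) {K c : ℝ} (hK : 0 ≤ K) (hc : 1 ≤ c) (b : TorusSite 2 L × Fin 2) :
    K * torusXYBondEnergy L (c * K) b ≤ K * (8 * (c * K) / (1 + 8 * (c * K))) := by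
  rcases hK.eq_or_lt with rfl | hKpos
  · simp
  · exact mul_le_mul_of_nonneg_left (torusXYBondEnergy_le hL (mul_pos (by linarith) hKpos) b) hK

end TorusBonds

/-! ### The energy-renormalised bounds -/

section Decay

variable {L : ℕ} [NeZero L] [MeasurableSpace Circle] [BorelSpace Circle]

/-- **The energy-weighted a-priori bound on the torus, graph form.** For `L ≥ 3`, `K ≥ 0`, `M`, every
`φ : (ℤ/Lℤ)² → ℝ` with `|φ_u − φ_v| ≤ M` on adjacent sites, and all `x, y`:
`|⟨cos(θ_x − θ_y)⟩_{K,L}| ≤ e^{−(φ_x − φ_y)} · exp((K·E_L(cosh(M)K)/2) Σ_u Σ_{v ∼ u} (cosh(φ_u − φ_v) − 1))`,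
`E_L(K′)` the bond energy of the torus at coupling `K′` (compare the tree's
`torusXY_abs_expect_cosDiff_le_exp_cosh_adj`, which has `K/2` in place of `K·E_L/2`).
[cite: McBryanSpencer1977, main theorem (proof: complex rotation)] -/
theorem torusXY_abs_expect_cosDiff_le_exp_energy_adj (hL : 3 ≤ L) {K : ℝ} (hK : 0 ≤ K) {M : ℝ}
    {φ : TorusSite 2 L → ℝ} (hφ : ∀ u v, (torusGraph 2 L).Adj u v → |φ u - φ v| ≤ M)
    (x y : TorusSite 2 L) :
    |(torusXY 2 L).expect K 1 (cosDiff x y)| ≤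
      Real.exp (-(φ x - φ y)) * Real.exp (K * torusXYBondEnergy L (Real.cosh M * K) (0, 0) / 2 *
        ∑ u : TorusSite 2 L, ∑ v : TorusSite 2 L,
          (if (torusGraph 2 L).Adj u v then (Real.cosh (φ u - φ v) - 1) else 0)) := by
  set E : ℝ := torusXYBondEnergy L (Real.cosh M * K) (0, 0) with hEdef
  have hM : ∀ a : TorusSite 2 L × Fin 2, |φ ((torusXY 2 L).tgt a) - φ ((torusXY 2 L).src a)| ≤ M := by
    intro a
    rw [abs_sub_comm]
    exact hφ _ _ (torusXY_adj_src_tgt hL a)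
  have h := (torusXY 2 L).abs_expectJ_cosDiff_le_exp_energy_cosh (J := fun _ => K) (fun _ => hK) hM x y
  rw [(torusXY 2 L).expect_one_eq_expectJ]
  refine h.trans_eq ?_
  rw [Real.exp_add]
  congr 2
  -- the modulated energies are all equal to `E`
  have hE : ∀ a : TorusSite 2 L × Fin 2, (torusXY 2 L).expectJ (fun _ => Real.cosh M * K)
      (reChar ((torusXY 2 L).bondChar a)) = E := fun a => by
    rw [torusXY_expectJ_reChar_bondChar, hEdef]; exact torusXYBondEnergy_eq _ a (0, 0)
  simp_rw [hE, torusXY_tgt', torusXY_src']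
  rw [sum_sum_ite_torusGraph_adj_real' hL (fun u v => Real.cosh (φ u - φ v) - 1)
    (fun u v => by rw [← Real.cosh_neg, neg_sub]), Fintype.sum_prod_type, Finset.mul_sum, Finset.mul_sum]
  refine Finset.sum_congr rfl fun z _ => ?_
  rw [Finset.mul_sum, Finset.mul_sum]
  refine Finset.sum_congr rfl fun i _ => ?_
  rw [← Real.cosh_neg, neg_sub]
  ring

/-- **Energy-renormalised McBryan–Spencer decay (energy class).** For the nearest-neighbour plane
rotator on `(ℤ/Lℤ)²`, `L ≥ 3`, coupling `K ≥ 0`: for every `q ≥ 0`, every `E ≥ 0` with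
`E_L(cosh(q log 2)·K) ≤ E` (an upper bound on the bond energy at the slightly larger coupling) and
`f = 2q − 2πK·E·q² ≥ 0`, and all `x, y`:
`|⟨cos(θ_x − θ_y)⟩_{K,L}| ≤ exp(K E (2πq² + 76q² + 544q⁴e^{2q²})) · 5^f · (dist(x,y) + 1)^{−f}`.
With `E = 1` this is the tree's `torusXY_abs_expect_cosDiff_le_rpow`; the optimal `q = 1/(2πKE)`
gives the exponent `1/(2πK·E)`. [cite: McBryanSpencer1977, main theorem] -/
theorem torusXY_abs_expect_cosDiff_le_rpow_of_bondEnergy_le (hL : 3 ≤ L) {K q f E : ℝ} (hK : 0 ≤ K)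
    (hq : 0 ≤ q) (hE0 : 0 ≤ E) (hE : torusXYBondEnergy L (Real.cosh (q * Real.log 2) * K) (0, 0) ≤ E)
    (hfq : f = 2 * q - 2 * Real.pi * (K * E) * q ^ 2) (hf : 0 ≤ f) (x y : TorusSite 2 L) :
    |(torusXY 2 L).expect K 1 (cosDiff x y)| ≤
      Real.exp (K * E * (2 * Real.pi * q ^ 2 + 76 * q ^ 2 + 544 * q ^ 4 * Real.exp (2 * q ^ 2))) *
        ((5 : ℝ) ^ f * ((torusDist x y : ℝ) + 1) ^ (-f)) := by
  have hcost : ∀ φ : TorusSite 2 L → ℝ, 0 ≤ ∑ u : TorusSite 2 L, ∑ v : TorusSite 2 L,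
      (if (torusGraph 2 L).Adj u v then (Real.cosh (φ u - φ v) - 1) else 0) := fun φ =>
    Finset.sum_nonneg fun u _ => Finset.sum_nonneg fun v _ => by
      split_ifs
      · exact sub_nonneg.2 (Real.one_le_cosh _)
      · exact le_rfl
  have h := le_rpow_euclid_of_apriori_grad L (K * E / 2) 1 q (|(torusXY 2 L).expect K 1 (cosDiff x y)|) f
    (by positivity) hq x y
    (fun φ _ _ hgrad => by
      have h1 := torusXY_abs_expect_cosDiff_le_exp_energy_adj hL hK hgrad x y
      rw [one_mul]
      refine h1.trans (mul_le_mul_of_nonneg_left ?_ (Real.exp_pos _).le)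
      rw [Real.exp_le_exp]
      refine mul_le_mul_of_nonneg_right ?_ (hcost φ)
      rw [div_le_div_iff_of_pos_right two_pos]
      exact mul_le_mul_of_nonneg_left hE hK)
    (by rw [hfq]; ring) hf
  rwa [show 2 * (K * E / 2) = K * E by ring] at h

/-- **Energy-renormalised McBryan–Spencer decay, explicit form.** For `L ≥ 3`, `K ≥ 0`, `q ≥ 0`,
with `K′ = cosh(q log 2)·K`, `ε = 8K′/(1 + 8K′) < 1` and `f = 2q − 2πK·ε·q² ≥ 0`, for all `x, y`:
`|⟨cos(θ_x − θ_y)⟩_{K,L}| ≤ exp(K ε (2πq² + 76q² + 544q⁴e^{2q²})) · 5^f · (dist(x,y) + 1)^{−f}`,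
uniformly in `L`. [cite: McBryanSpencer1977, main theorem] -/
theorem torusXY_abs_expect_cosDiff_le_rpow_renormalized (hL : 3 ≤ L) {K q f : ℝ} (hK : 0 ≤ K)
    (hq : 0 ≤ q)
    (hfq : f = 2 * q - 2 * Real.pi * (K * (8 * (Real.cosh (q * Real.log 2) * K) /
      (1 + 8 * (Real.cosh (q * Real.log 2) * K)))) * q ^ 2) (hf : 0 ≤ f) (x y : TorusSite 2 L) :
    |(torusXY 2 L).expect K 1 (cosDiff x y)| ≤
      Real.exp (K * (8 * (Real.cosh (q * Real.log 2) * K) / (1 + 8 * (Real.cosh (q * Real.log 2) * K))) *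
          (2 * Real.pi * q ^ 2 + 76 * q ^ 2 + 544 * q ^ 4 * Real.exp (2 * q ^ 2))) *
        ((5 : ℝ) ^ f * ((torusDist x y : ℝ) + 1) ^ (-f)) := by
  set c : ℝ := Real.cosh (q * Real.log 2) with hc
  have hc1 : 1 ≤ c := Real.one_le_cosh _
  have hK' : 0 ≤ c * K := mul_nonneg (by linarith) hK
  have hε0 : 0 ≤ 8 * (c * K) / (1 + 8 * (c * K)) := by positivity
  rcases hK.eq_or_lt with hK0 | hKpos
  · -- `K = 0`: the energy bound is not needed (`K·E = 0 = K·ε`)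
    subst hK0
    have h := torusXY_abs_expect_cosDiff_le_rpow_of_bondEnergy_le hL (K := 0) le_rfl hq
      (E := max 0 (torusXYBondEnergy L (Real.cosh (q * Real.log 2) * 0) (0, 0))) (le_max_left _ _)
      (le_max_right _ _) (f := f) (by rw [hfq]; ring) hf x y
    simpa using h
  · have hE : torusXYBondEnergy L (c * K) (0, 0) ≤ 8 * (c * K) / (1 + 8 * (c * K)) :=
      torusXYBondEnergy_le hL (mul_pos (by linarith) hKpos) (0, 0)
    exact torusXY_abs_expect_cosDiff_le_rpow_of_bondEnergy_le hL hK hq hε0 hE hfq hf x y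

omit [MeasurableSpace Circle] [BorelSpace Circle] in
/-- **The renormalised spin-wave exponent exceeds the McBryan–Spencer exponent**: for `K > 0`,
`(1 + 1/(1 + 8·cosh(log 2/(2πK))·K))/(2πK) > 1/(2πK)`. [cite: FriedliVelenik2017, (9.21) (spin-wave exponent 1/(2πβ))] -/
theorem renormalizedSpinWave_exponent_gt {K : ℝ} (hK : 0 < K) :
    1 / (2 * Real.pi * K) <
      (1 + 1 / (1 + 8 * (Real.cosh (Real.log 2 / (2 * Real.pi * K)) * K))) / (2 * Real.pi * K) := by
  have hden : 0 < 2 * Real.pi * K := by positivity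
  rw [div_lt_div_iff_of_pos_right hden]
  have : 0 < 1 / (1 + 8 * (Real.cosh (Real.log 2 / (2 * Real.pi * K)) * K)) := by
    have := Real.one_le_cosh (Real.log 2 / (2 * Real.pi * K))
    positivity
  linarith

/-- **Energy-renormalised McBryan–Spencer decay at the spin-wave charge** (`q₀ = 1/(2πK)`): for the
nearest-neighbour plane rotator on `(ℤ/Lℤ)²`, `L ≥ 3`, `K > 0`, all `x, y`, uniformly in `L`,

  `|⟨cos(θ_x − θ_y)⟩_{K,L}| ≤ C(K) · (dist(x,y) + 1)^{−f₀}`,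
  `f₀ = (1 + 1/(1 + 8K′))/(2πK)`, `K′ = cosh(log 2/(2πK))·K`,

with `C(K) = exp(K ε (2πq₀² + 76q₀² + 544q₀⁴e^{2q₀²}))·5^{f₀}`, `ε = 8K′/(1 + 8K′)`. The exponent
`f₀` is STRICTLY LARGER than the spin-wave / McBryan–Spencer value `1/(2πK)` of
`torusXY_abs_expect_cosDiff_le_rpow_spinWave` (`renormalizedSpinWave_exponent_gt`): the coupling in
the spin-wave exponent is renormalised by the rigorous energy ceiling `ε < 1`.
[cite: McBryanSpencer1977, main theorem] -/
theorem torusXY_abs_expect_cosDiff_le_rpow_renormalizedSpinWave (hL : 3 ≤ L) {K : ℝ} (hK : 0 < K)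
    (x y : TorusSite 2 L) :
    |(torusXY 2 L).expect K 1 (cosDiff x y)| ≤
      (Real.exp (K * (8 * (Real.cosh (Real.log 2 / (2 * Real.pi * K)) * K) /
            (1 + 8 * (Real.cosh (Real.log 2 / (2 * Real.pi * K)) * K))) *
          (2 * Real.pi * (1 / (2 * Real.pi * K)) ^ 2 + 76 * (1 / (2 * Real.pi * K)) ^ 2 +
            544 * (1 / (2 * Real.pi * K)) ^ 4 * Real.exp (2 * (1 / (2 * Real.pi * K)) ^ 2))) *
        (5 : ℝ) ^ ((1 + 1 / (1 + 8 * (Real.cosh (Real.log 2 / (2 * Real.pi * K)) * K))) / (2 * Real.pi * K))) *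
      ((torusDist x y : ℝ) + 1) ^
        (-((1 + 1 / (1 + 8 * (Real.cosh (Real.log 2 / (2 * Real.pi * K)) * K))) / (2 * Real.pi * K))) := by
  set q : ℝ := 1 / (2 * Real.pi * K) with hqdef
  have hq : 0 ≤ q := by positivity
  have hqlog : q * Real.log 2 = Real.log 2 / (2 * Real.pi * K) := by rw [hqdef]; ring
  set K' : ℝ := Real.cosh (Real.log 2 / (2 * Real.pi * K)) * K with hK'
  set ε : ℝ := 8 * K' / (1 + 8 * K') with hεdef
  set f : ℝ := (1 + 1 / (1 + 8 * K')) / (2 * Real.pi * K) with hfdef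
  have hK'0 : 0 ≤ K' := mul_nonneg (by have := Real.one_le_cosh (Real.log 2 / (2 * Real.pi * K)); linarith) hK.le
  have h18 : (0 : ℝ) < 1 + 8 * K' := by linarith
  have hfq : f = 2 * q - 2 * Real.pi * (K * ε) * q ^ 2 := by
    rw [hfdef, hεdef, hqdef]
    field_simp
    ring
  have hf : 0 ≤ f := by rw [hfdef]; positivity
  have h := torusXY_abs_expect_cosDiff_le_rpow_renormalized hL hK.le hq (f := f)
    (by rw [hqlog]; exact hfq) hf x y
  rw [hqlog] at h
  rw [← mul_assoc] at h
  exact h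

/-! ### The energy exponent `1/(2πK·E)` (SCHA form) -/

/-- **The energy exponent.** For `L ≥ 3`, `K > 0` and every `E > 0` dominating the bond energy of the
torus at the coupling `cosh(log 2/(2πKE))·K`, the two-point function decays with the exponent
`1/(2πK·E)` EXACTLY (the charge `q = 1/(2πKE)` in `torusXY_abs_expect_cosDiff_le_rpow_of_bondEnergy_le`):
`|⟨cos(θ_x − θ_y)⟩_{K,L}| ≤ exp(K E (2πq² + 76q² + 544q⁴e^{2q²})) · 5^{1/(2πKE)} · (dist(x,y) + 1)^{−1/(2πKE)}`.
This is the rigorous one-step version of the self-consistent-harmonic form `η = T/(2πJ⟨cos ∇θ⟩)` with a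
certified energy ceiling `E` in place of `⟨cos ∇θ⟩`. [cite: McBryanSpencer1977, main theorem] -/
theorem torusXY_abs_expect_cosDiff_le_rpow_energyExponent (hL : 3 ≤ L) {K E : ℝ} (hK : 0 < K)
    (hE : 0 < E)
    (hEL : torusXYBondEnergy L (Real.cosh (Real.log 2 / (2 * Real.pi * K * E)) * K) (0, 0) ≤ E)
    (x y : TorusSite 2 L) :
    |(torusXY 2 L).expect K 1 (cosDiff x y)| ≤
      Real.exp (K * E * (2 * Real.pi * (1 / (2 * Real.pi * K * E)) ^ 2 + 76 * (1 / (2 * Real.pi * K * E)) ^ 2 +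
          544 * (1 / (2 * Real.pi * K * E)) ^ 4 * Real.exp (2 * (1 / (2 * Real.pi * K * E)) ^ 2))) *
        ((5 : ℝ) ^ (1 / (2 * Real.pi * K * E)) *
          ((torusDist x y : ℝ) + 1) ^ (-(1 / (2 * Real.pi * K * E)))) := by
  set q : ℝ := 1 / (2 * Real.pi * K * E) with hqdef
  have hq : 0 ≤ q := by positivity
  have hqlog : q * Real.log 2 = Real.log 2 / (2 * Real.pi * K * E) := by rw [hqdef]; ring
  have hfq : q = 2 * q - 2 * Real.pi * (K * E) * q ^ 2 := by
    rw [hqdef]; field_simp; ring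
  exact torusXY_abs_expect_cosDiff_le_rpow_of_bondEnergy_le hL hK.le hq hE.le (by rw [hqlog]; exact hEL)
    hfq hq x y

/-- **The energy exponent with the explicit admissibility test.** For `L ≥ 3`, `K > 0` and every `E > 0`
with `8K″/(1 + 8K″) ≤ E`, `K″ = cosh(log 2/(2πKE))·K` (a closed-form check; e.g. `E = 0.901` passes at
`K = 1.12`), the exponent `1/(2πK·E)` holds uniformly in `L` (`torusXYBondEnergy_le`).
[cite: McBryanSpencer1977, main theorem] -/
theorem torusXY_abs_expect_cosDiff_le_rpow_energyExponent_of_le (hL : 3 ≤ L) {K E : ℝ} (hK : 0 < K)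
    (hE : 0 < E)
    (hadm : 8 * (Real.cosh (Real.log 2 / (2 * Real.pi * K * E)) * K) /
        (1 + 8 * (Real.cosh (Real.log 2 / (2 * Real.pi * K * E)) * K)) ≤ E)
    (x y : TorusSite 2 L) :
    |(torusXY 2 L).expect K 1 (cosDiff x y)| ≤
      Real.exp (K * E * (2 * Real.pi * (1 / (2 * Real.pi * K * E)) ^ 2 + 76 * (1 / (2 * Real.pi * K * E)) ^ 2 +
          544 * (1 / (2 * Real.pi * K * E)) ^ 4 * Real.exp (2 * (1 / (2 * Real.pi * K * E)) ^ 2))) *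
        ((5 : ℝ) ^ (1 / (2 * Real.pi * K * E)) *
          ((torusDist x y : ℝ) + 1) ^ (-(1 / (2 * Real.pi * K * E)))) := by
  have hc : 0 < Real.cosh (Real.log 2 / (2 * Real.pi * K * E)) * K :=
    mul_pos (by have := Real.one_le_cosh (Real.log 2 / (2 * Real.pi * K * E)); linarith) hK
  exact torusXY_abs_expect_cosDiff_le_rpow_energyExponent hL hK hE
    ((torusXYBondEnergy_le hL hc (0, 0)).trans hadm) x y

end Decay

end Literature.Probability.LatticeModels

end
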